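import Summits.QuantumAdvantage.QuantumAdvantage.Theorems.WbwObfuscatedGluedTreesKowObfuscationMonotone
import Summits.QuantumAdvantage.QuantumAdvantage.Theorems.WbwObfuscatedGluedTreesKowLevelVocabulary

/-!
# `WbwObfuscatedGluedTrees` (stmt-QuantumAdvantage-2340) — line `knowledge-of-walk-split`, instantiation pass: stub `level_obfuscationMonotone`

The registered stub `level_obfuscationMonotone` of the instantiation pass of the line
`knowledge-of-walk-split` (crux `WbwObfuscatedGluedTrees`, route `WhiteBoxWalk`; lead
prover-line-stmt-QuantumAdvantage-2340-c1-0): the LEVEL-AWARE re-issue of `stub_obfuscationMonotone`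
(`WbwObfuscatedGluedTreesKowObfuscationMonotone`).  For an efficient obfuscator `O` (no security property is
used), a unary-poly-time schedule `κ ≤ poly`, key length `h n ≤ n`, polynomially long clear instances and the
eventual (`n ≥ n₀`) coin discipline `O.coins (κ n) (C n k) ≤ n − h n` on keys `k` of length `h n`,
`ClauseC (genClearL h m C nm) (keyedL h ans) → ClauseC (genObfL O κ h m C nm) (keyedL h ans)`
for a level-aware key-indexed circuit family `C n k` of arity `m n k` (vocabulary of
`WbwObfuscatedGluedTreesKowLevelVocabulary`, `ClauseC` of `Negative/LoadBearing`).

Proof: the level-oblivious proof, level by level.  At level `n` the genuine clear / obfuscated inputs are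
`ObfMono.x0 (m n) (C n) (nm n) n k` and `ObfMono.x1 O κ (m n) (C n) (nm n) n k r` — the inputs of the
level-oblivious family `(m n, C n, nm n)` frozen at level `n` — so the whole per-input analysis of the
reduction `ObfMono.redAlg K Ob A₁ qO QP` (`ObfMono.inO_x0`, `newInput_x0`, `length_x1_le`, `budget_le`,
`pr_redAlg_ge`, `isPPT_redAlg`) is imported as is; only the per-level domination
(`LevelObfMono.domination`, the copy of `ObfMono.domination` with the level passed to the family and the two
per-key hypotheses — short clear instances, coin discipline — taken directly at level `n`) is re-proved.
Then, for a PPT `A` against the obfuscated instances, `A₁ = CoinNormalisation.norm A pA` and the PPT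
`A' = ObfMono.redAlg K Ob A₁ qO QP` against the clear instances satisfy
`succ_A(genObfL, n) ≤ lossP(n) · succ_{A'}(genClearL, n)` for `n ≥ n₀`, and the right-hand side decays
superpolynomially (`SuperpolynomialDecay.polynomial_mul`, `trans_eventually_abs_le` along
`eventually_ge_atTop n₀`).
-/

set_option linter.dupNamespace false

noncomputable section

namespace Summit.QuantumAdvantage.QuantumAdvantage.Theorems.WbwObfuscatedGluedTrees.KnowledgeOfWalk

open Literature.Computability.Cryptography Literature.Computability.Complexity Filter Asymptotics
open _root_.Computability Brick Plumb
open Summit.QuantumAdvantage.QuantumAdvantage.Theorems.WbwObfuscatedGluedTrees.Negative (ClauseC)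

namespace LevelObfMono

open ObfMono

/-! ### Genuine inputs at level `n`: the frozen family `(m n, C n, nm n)` -/

/-- The clause-(C) input for `genClearL` at a seed of length `n` is `ObfMono.x0` of the family frozen at
level `n`, at its key. [folklore] -/
theorem x0L_eq (h : ℕ → ℕ) (m : ℕ → List Bool → ℕ) (C : (n : ℕ) → (k : List Bool) → Circuit (Fin (m n k)))
    (nm : ℕ → List Bool → List Bool) {n : ℕ} {s : List Bool} (hs : s.length = n) :
    boolPair (unaryEncodeNat n) (genClearL h m C nm s) = x0 (m n) (C n) (nm n) n (s.take (h n)) := by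
  subst hs; rfl

/-- The clause-(C) input for `genObfL` at a seed of length `n` is `ObfMono.x1` of the family frozen at
level `n`, at its key and the coin prefix of the seed tail. [folklore] -/
theorem x1L_eq (O : CircuitObfuscator) (κ h : ℕ → ℕ) (m : ℕ → List Bool → ℕ)
    (C : (n : ℕ) → (k : List Bool) → Circuit (Fin (m n k))) (nm : ℕ → List Bool → List Bool) {n : ℕ}
    {s : List Bool} (hs : s.length = n) :
    boolPair (unaryEncodeNat n) (genObfL O κ h m C nm s) =
      x1 O κ (m n) (C n) (nm n) n (s.take (h n))
        ((s.drop (h n)).take (O.coins (κ n) (C n (s.take (h n))))) := by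
  subst hs; rfl

/-- The key of a seed of length `n` has length `h n` (`h n ≤ n`). [folklore] -/
theorem length_key {h : ℕ → ℕ} {n : ℕ} (hh : h n ≤ n) {s : List Bool} (hs : s.length = n) :
    (s.take (h n)).length = h n := by
  rw [List.length_take, hs]
  exact min_eq_left hh

/-- The clear input of a key with a short clear instance is short: `|x0| ≤ 2n + 2 + q n`. [folklore] -/
theorem length_x0_le_of {m : ℕ → List Bool → ℕ} {C : (n : ℕ) → (k : List Bool) → Circuit (Fin (m n k))}
    {nm : ℕ → List Bool → List Bool} {q : Polynomial ℕ} {n : ℕ} {k : List Bool}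
    (hq : (boolPair (encodeSizedCircuit ⟨m n k, C n k⟩) (nm n k)).length ≤ q.eval n) :
    (x0 (m n) (C n) (nm n) n k).length ≤ 2 * n + 2 + q.eval n := by
  have h1 : (x0 (m n) (C n) (nm n) n k).length =
      2 * n + 2 + (boolPair (encodeSizedCircuit ⟨m n k, C n k⟩) (nm n k)).length := by
    simp only [x0, length_boolPair, FPExtension.unaryEncodeNat_eq_ones, List.length_replicate]
  omega

/-! ### Per-level domination `succ_A(genObfL) ≤ loss(n) · succ_{A'}(genClearL)` -/

/-- **Domination at level `n`** (level-aware copy of `ObfMono.domination`).  For an adversary `A` with coin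
bound `pA`, a prefix-stable `A₁` dominating it at loss `2^{width pA |x|}` with demand `≤ 2 pA + 1`, total
extensions `K` of the schedule and `Ob` of the obfuscator (output length `≤ sOb`), and `O.coinLen ≤ qO`: at
every level `n` with `h n ≤ n` at which the clear instances of keys of length `h n` have length `≤ q n` and
the coin discipline `O.coins (κ n) (C n k) ≤ n − h n` holds, the success of `A` against the obfuscated
instances is at most `lossP(n)` times the success of the reduction against the clear instances (seed law:
the obfuscator's coins are a uniform prefix of the uniform seed tail; coin-count guessing for `O` and for
`A`). [cite: AroraBarakCC2009, §7.1] -/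
theorem domination {O : CircuitObfuscator} {κ h : ℕ → ℕ} {m : ℕ → List Bool → ℕ}
    {C : (n : ℕ) → (k : List Bool) → Circuit (Fin (m n k))} {nm ans : ℕ → List Bool → List Bool}
    {K Ob : List Bool → List Bool} {A A₁ : RandAlg (List Bool) (List Bool)} {pA qO pκ sOb q : Polynomial ℕ}
    (hK : ∀ n, K (unaryEncodeNat n) = unaryEncodeNat (κ n))
    (hOb : ∀ (κ' n' : ℕ) (C' : Circuit (Fin n')) (r : List Bool),
      Ob (boolPair (boolPair (unaryEncodeNat κ') (encodeSizedCircuit ⟨n', C'⟩)) r) =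
        encodeSizedCircuit ⟨n', O.obf κ' C' r⟩)
    (hsOb : ∀ y, (Ob y).length ≤ sOb.eval y.length) (hpκ : ∀ n, κ n ≤ pκ.eval n)
    (hqO : ∀ L, O.coinLen L ≤ qO.eval L)
    (hstab : ∀ (x : List Bool) (E : Set (List Bool)) (N : ℕ), A₁.coinLen x.length ≤ N →
      uniformProb N {ρ | A₁.run x ρ ∈ E} = A₁.pr id x E)
    (hdomA : ∀ (x : List Bool) (E : Set (List Bool)),
      A.pr id x E ≤ (2 : ℝ) ^ CoinNormalisation.width pA x.length * A₁.pr id x E)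
    (hA₁c : ∀ L, A₁.coinLen L ≤ 2 * pA.eval L + 1) {n : ℕ} (hh : h n ≤ n)
    (hq : ∀ k : List Bool, k.length = h n →
      (boolPair (encodeSizedCircuit ⟨m n k, C n k⟩) (nm n k)).length ≤ q.eval n)
    (hcoins : ∀ k : List Bool, k.length = h n → O.coins (κ n) (C n k) ≤ n - h n) :
    uniformAvg n (fun s => A.pr id (boolPair (unaryEncodeNat n) (genObfL O κ h m C nm s))
        {y | keyedL h ans s <+: y}) ≤
      (((lossP pκ qO sOb pA q).eval n : ℕ) : ℝ) *
        uniformAvg n (fun s => (redAlg K Ob A₁ qO (QP pκ qO sOb pA)).pr id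
          (boolPair (unaryEncodeNat n) (genClearL h m C nm s)) {y | keyedL h ans s <+: y}) := by
  obtain ⟨Lmax, hLmax⟩ : ∃ L : ℕ, L = 2 * n + 2 + q.eval n := ⟨_, rfl⟩
  obtain ⟨ℓA, hℓA⟩ : ∃ t : ℝ, t = 2 * ((pA.eval ((XP pκ qO sOb).eval Lmax) : ℕ) : ℝ) + 2 := ⟨_, rfl⟩
  obtain ⟨ℓO, hℓO⟩ : ∃ t : ℝ, t = 2 * ((qO.eval ((L0P pκ).eval Lmax) : ℕ) : ℝ) + 2 := ⟨_, rfl⟩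
  -- keys of length `h n`: the clear input is short
  have hkey : ∀ k : List Bool, k.length = h n → (x0 (m n) (C n) (nm n) n k).length ≤ Lmax :=
    fun k hk => hLmax ▸ length_x0_le_of (hq k hk)
  -- Step 1: `A ≤ ℓA · A₁` on every obfuscated instance
  have hstep1 : ∀ s : List Bool, s.length = n →
      A.pr id (boolPair (unaryEncodeNat n) (genObfL O κ h m C nm s)) {y | keyedL h ans s <+: y} ≤
        ℓA * A₁.pr id (boolPair (unaryEncodeNat n) (genObfL O κ h m C nm s))
          {y | keyedL h ans s <+: y} := by
    intro s hs
    have hlen : (boolPair (unaryEncodeNat n) (genObfL O κ h m C nm s)).length ≤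
        (XP pκ qO sOb).eval Lmax := by
      rw [x1L_eq O κ h m C nm hs]
      refine (length_x1_le hK hOb (m n) (C n) (nm n) n _ hsOb hpκ ?_).trans
        (SeedLaw.natPoly_eval_mono _ ?_)
      · rw [List.length_take, coins_eq hK (m n) (C n) (nm n) n]
        exact (min_le_left _ _).trans (hqO _)
      · exact hkey _ (length_key hh hs)
    refine (hdomA _ _).trans (mul_le_mul_of_nonneg_right ?_ (RandAlg.pr_nonneg _ _ _ _))
    refine (CoinNormalisation.two_pow_width_le pA _).trans ?_
    have := SeedLaw.natPoly_eval_mono pA hlen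
    rw [hℓA]
    exact_mod_cast (by omega : 2 * pA.eval (boolPair (unaryEncodeNat n) (genObfL O κ h m C nm s)).length + 2 ≤
      2 * pA.eval ((XP pκ qO sOb).eval Lmax) + 2)
  -- Step 2: the seed law
  have hstep2 : uniformAvg n (fun s => A₁.pr id (boolPair (unaryEncodeNat n) (genObfL O κ h m C nm s))
      {y | keyedL h ans s <+: y}) =
      uniformAvg (h n) (fun k => uniformAvg (O.coins (κ n) (C n k))
        (fun r => A₁.pr id (x1 O κ (m n) (C n) (nm n) n k r) {y | ans n k <+: y})) := by
    refine SeedLaw.uniformAvg_eq_key_coins hh (fun k => O.coins (κ n) (C n k)) hcoins _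
      (fun k r => A₁.pr id (x1 O κ (m n) (C n) (nm n) n k r) {y | ans n k <+: y}) ?_
    intro s hs
    rw [x1L_eq O κ h m C nm hs, keyedL_eq h ans hs]
  -- Step 3: per key, the guessing inequality of the reduction
  have hstep3 : ∀ k : List Bool, k.length = h n →
      uniformAvg (O.coins (κ n) (C n k))
          (fun r => A₁.pr id (x1 O κ (m n) (C n) (nm n) n k r) {y | ans n k <+: y}) ≤
        ℓO * (redAlg K Ob A₁ qO (QP pκ qO sOb pA)).pr id (x0 (m n) (C n) (nm n) n k)
          {y | ans n k <+: y} := by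
    intro k hk
    have hj : O.coins (κ n) (C n k) ≤ qO.eval (inO K (x0 (m n) (C n) (nm n) n k)).length := by
      rw [coins_eq hK (m n) (C n) (nm n) n k]; exact hqO _
    have hge := pr_redAlg_ge K Ob A₁ qO (QP pκ qO sOb pA) hstab (x0 (m n) (C n) (nm n) n k)
      {y | ans n k <+: y} hj (fun r hr => budget_le hK hOb (m n) (C n) (nm n) n k hsOb hpκ hA₁c hr)
    simp only [newInput_x0 hK hOb] at hge
    have hpos : (0 : ℝ) < 2 ^ CoinNormalisation.width qO (inO K (x0 (m n) (C n) (nm n) n k)).length := by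
      positivity
    have h2w : (2 : ℝ) ^ CoinNormalisation.width qO (inO K (x0 (m n) (C n) (nm n) n k)).length ≤ ℓO := by
      refine (CoinNormalisation.two_pow_width_le qO _).trans ?_
      have h0 := length_inO_x0_le hK (m n) (C n) (nm n) n k hpκ
      have h1 := SeedLaw.natPoly_eval_mono (L0P pκ) (hkey k hk)
      have := SeedLaw.natPoly_eval_mono qO (h0.trans h1)
      rw [hℓO]
      exact_mod_cast (by omega : 2 * qO.eval (inO K (x0 (m n) (C n) (nm n) n k)).length + 2 ≤
        2 * qO.eval ((L0P pκ).eval Lmax) + 2)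
    calc uniformAvg (O.coins (κ n) (C n k))
          (fun r => A₁.pr id (x1 O κ (m n) (C n) (nm n) n k r) {y | ans n k <+: y})
        = 2 ^ CoinNormalisation.width qO (inO K (x0 (m n) (C n) (nm n) n k)).length *
            (1 / 2 ^ CoinNormalisation.width qO (inO K (x0 (m n) (C n) (nm n) n k)).length *
              uniformAvg (O.coins (κ n) (C n k))
                (fun r => A₁.pr id (x1 O κ (m n) (C n) (nm n) n k r) {y | ans n k <+: y})) := by
          field_simp
      _ ≤ 2 ^ CoinNormalisation.width qO (inO K (x0 (m n) (C n) (nm n) n k)).length *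
            (redAlg K Ob A₁ qO (QP pκ qO sOb pA)).pr id (x0 (m n) (C n) (nm n) n k)
              {y | ans n k <+: y} :=
          mul_le_mul_of_nonneg_left hge hpos.le
      _ ≤ ℓO * (redAlg K Ob A₁ qO (QP pκ qO sOb pA)).pr id (x0 (m n) (C n) (nm n) n k)
            {y | ans n k <+: y} :=
          mul_le_mul_of_nonneg_right h2w (RandAlg.pr_nonneg _ _ _ _)
  -- Step 4: the clear side is a function of the key only
  have hstep4 : uniformAvg (h n) (fun k => (redAlg K Ob A₁ qO (QP pκ qO sOb pA)).pr id
      (x0 (m n) (C n) (nm n) n k) {y | ans n k <+: y}) =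
      uniformAvg n (fun s => (redAlg K Ob A₁ qO (QP pκ qO sOb pA)).pr id
        (boolPair (unaryEncodeNat n) (genClearL h m C nm s)) {y | keyedL h ans s <+: y}) := by
    rw [← SeedLaw.uniformAvg_take_of_le hh (fun k => (redAlg K Ob A₁ qO (QP pκ qO sOb pA)).pr id
      (x0 (m n) (C n) (nm n) n k) {y | ans n k <+: y})]
    refine uniformAvg_congr fun s hs => ?_
    rw [x0L_eq h m C nm hs, keyedL_eq h ans hs]
  -- assembly
  have hℓA0 : 0 ≤ ℓA := by rw [hℓA]; positivity
  have hloss : (((lossP pκ qO sOb pA q).eval n : ℕ) : ℝ) = ℓA * ℓO := by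
    rw [eval_lossP, hℓA, hℓO, hLmax]
    push_cast
    ring
  calc uniformAvg n (fun s => A.pr id (boolPair (unaryEncodeNat n) (genObfL O κ h m C nm s))
        {y | keyedL h ans s <+: y})
      ≤ uniformAvg n (fun s => ℓA * A₁.pr id (boolPair (unaryEncodeNat n) (genObfL O κ h m C nm s))
          {y | keyedL h ans s <+: y}) := SeedLaw.uniformAvg_mono hstep1
    _ = ℓA * uniformAvg (h n) (fun k => uniformAvg (O.coins (κ n) (C n k))
          (fun r => A₁.pr id (x1 O κ (m n) (C n) (nm n) n k r) {y | ans n k <+: y})) := by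
        rw [SeedLaw.uniformAvg_const_mul, hstep2]
    _ ≤ ℓA * uniformAvg (h n) (fun k => ℓO * (redAlg K Ob A₁ qO (QP pκ qO sOb pA)).pr id
          (x0 (m n) (C n) (nm n) n k) {y | ans n k <+: y}) :=
        mul_le_mul_of_nonneg_left (SeedLaw.uniformAvg_mono hstep3) hℓA0
    _ = ℓA * ℓO * uniformAvg n (fun s => (redAlg K Ob A₁ qO (QP pκ qO sOb pA)).pr id
          (boolPair (unaryEncodeNat n) (genClearL h m C nm s)) {y | keyedL h ans s <+: y}) := by
        rw [SeedLaw.uniformAvg_const_mul, hstep4, mul_assoc]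
    _ = _ := by rw [hloss]

end LevelObfMono

/-- **STUB `level_obfuscationMonotone` of line `knowledge-of-walk-split` (instantiation pass) — obfuscation is
monotone, level-aware families.**  Clause (C) for the CLEAR level-aware key-indexed circuit family `C n k`
(instances `⟨code (C n k), nm n k⟩`, keyed answer `ans n k`, `k = s.take (h n)` at seeds of length `n`)
implies clause (C) for its honest obfuscations `⟨code (O(κ n, C n k; U)), nm n k⟩`, for every EFFICIENT
obfuscator `O` (no security property is used), unary-poly-time schedule `κ ≤ poly`, key length `h n ≤ n`,
polynomially long clear instances, and the EVENTUAL (`n ≥ n₀`) coin discipline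
`O.coins (κ n) (C n k) ≤ n − h n`.  Proof: a PPT `A` against the obfuscated instances yields the PPT
reduction `ObfMono.redAlg` against the clear instances (it recomputes `O`'s input `⟨1^{κ n}, code (C n k)⟩`,
GUESSES `O`'s coin count, re-obfuscates with a prefix of its own coins and runs the coin-count
normalisation of `A`; `ObfMono.isPPT_redAlg`); `succ_A(genObfL, n) ≤ lossP(n) · succ_{A'}(genClearL, n)` for
`n ≥ n₀` (`LevelObfMono.domination`), and the right-hand side decays superpolynomially by the hypothesis.
[cite: AroraBarakCC2009, §7.1] -/
theorem level_obfuscationMonotone : ∀ (O : CircuitObfuscator), O.IsEfficient → ∀ (κ h : ℕ → ℕ)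
    (m : ℕ → List Bool → ℕ) (C : (n : ℕ) → (k : List Bool) → Circuit (Fin (m n k)))
    (nm ans : ℕ → List Bool → List Bool),
    PolyTimeComputable Computability.unaryEncodeNat Computability.unaryEncodeNat κ →
    (∃ p : Polynomial ℕ, ∀ n, κ n ≤ p.eval n) → (∀ n, h n ≤ n) →
    (∃ q : Polynomial ℕ, ∀ (n : ℕ) (k : List Bool), k.length = h n →
      (boolPair (encodeSizedCircuit ⟨m n k, C n k⟩) (nm n k)).length ≤ q.eval n) →
    (∃ n₀ : ℕ, ∀ n, n₀ ≤ n → ∀ k : List Bool, k.length = h n → O.coins (κ n) (C n k) ≤ n - h n) →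
    ClauseC (genClearL h m C nm) (keyedL h ans) → ClauseC (genObfL O κ h m C nm) (keyedL h ans) := by
  intro O hO κ h m C nm ans hκ hκp hh hq hcoins hC A hA
  obtain ⟨pκ, hpκ⟩ := hκp
  obtain ⟨q, hq⟩ := hq
  obtain ⟨pA, hpA⟩ := hA.2
  obtain ⟨qO, hqO⟩ := hO.2
  obtain ⟨K, hK, hKval⟩ := FPExtension.exists_FP_unary hκ
  obtain ⟨Ob, hOb, hObval⟩ := FPExtension.exists_FP_obf hO
  obtain ⟨sOb, hsOb⟩ := FPExtension.exists_poly_length_le hOb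
  obtain ⟨n₀, hcoins⟩ := hcoins
  have hqO' : ∀ L, O.coinLen L ≤ qO.eval L := hqO
  have hA' : IsPPT (ObfMono.redAlg K Ob (CoinNormalisation.norm A pA) qO (ObfMono.QP pκ qO sOb pA)) id :=
    ObfMono.isPPT_redAlg hK hOb (CoinNormalisation.isPPT_norm hA pA) _ _
  have hA₁c : ∀ L, (CoinNormalisation.norm A pA).coinLen L ≤ 2 * pA.eval L + 1 := fun L => by
    have := CoinNormalisation.width_le pA L
    show CoinNormalisation.width pA L + pA.eval L ≤ _
    omega
  refine ((hC _ hA').polynomial_mul ((ObfMono.lossP pκ qO sOb pA q).map (Nat.castRingHom ℝ)))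
    |>.trans_eventually_abs_le ?_
  filter_upwards [Filter.eventually_ge_atTop n₀] with n hn
  simp only [Function.comp_apply, Polynomial.eval_natCast_map, eq_natCast]
  rw [abs_of_nonneg (uniformAvg_nonneg fun s => RandAlg.pr_nonneg _ _ _ _),
    abs_of_nonneg (mul_nonneg (Nat.cast_nonneg _) (uniformAvg_nonneg fun s => RandAlg.pr_nonneg _ _ _ _))]
  exact LevelObfMono.domination hKval hObval hsOb hpκ hqO'
    (fun x E N hN => CoinNormalisation.uniformProb_norm_of_le A pA x E hN)
    (fun x E => CoinNormalisation.pr_le_two_pow_mul A pA x E (hpA _)) hA₁c (hh n) (hq n) (hcoins n hn)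

end Summit.QuantumAdvantage.QuantumAdvantage.Theorems.WbwObfuscatedGluedTrees.KnowledgeOfWalk

end
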